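import Summits.QuantumFields.YangMills.Theorems.BalabanUVNodesK1EndOfNodes13PWSOfRunRemAt
import Literature.MathematicalPhysics.QuantumFieldTheory.Balaban1983to89.Node00.Record13SClassSepCoPHChiCmap

/-!
# BalabanUVNodes ∕ K1ᴬ — dag-lead HANDS-3 (ii): `K1EndOfNodes13PWSOfRunRemAt.stabilityB_body_of_rung1At_of_runLetters` RE-ISSUED AT THE RE-CENTRED (Ax) RECORD —
# the END + window of K1ᴬ `StabilityBRunRowsAtRecordR13SepCoPHVAx`'s consequent AT θ from a rung-1 datum and RUN letters only, and the route decl BY NAME from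
# ONE ∃-side producer in the run-LETTER currency

TRACK A (YM-PLAN §2d), node N24 (binder B2, COMPOSITE), seat `pub-ymgap-dag-n24-c` g23 (op 5b ENGINE-LANE HAND, dag-lead g40 HANDS I.21531 ∕ g40 WORDS 581 HANDS-3 (ii);
`--kind proof --supports stmt-QuantumFields-27239 --as helper`, count-neutral).  Key of record: K1ᴬ `StabilityBRunRowsAtRecordR13SepCoPHVAx` = stmt-QuantumFields-27239
(route rev 31∕33, director-ym №467 (D) V1′ ADD-AND-REGLUE: K1⁹'s text under σ — `Provisos₁₃SepCoPH ↦ Provisos₁₃SepCoPHAx`, `betaOfRecord₁₃ ↦ betaOfRecord₁₃Ax`,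
`datumOfRecord₁₃SepCoPHV ↦ datumOfRecord₁₃SepCoPHVAx`, `Revision₁₃ ↦ Revision₁₃Ax`, `SlotsNondegenerate₁₃ ↦ SlotsNondegenerate₁₃Ax` — the same statement read at the record
whose (2.9) small-field cut-off is centred at print's block-axial representative, `Node00/Record13SepCoPHChi` §A).

WHAT.  The parent `BalabanUVNodesK1EndOfNodes13PWSOfRunRemAt` (dag-n24-w1 g2, K1⁷ era) §2 — ★ `endStatementBPrinted_window_of_isRecordOfRecord₁₃CSepCoPHS_of_nodes_of_runLetters`
(D-keyed at any S-class record: nodes + DEF-1's run-wise constant remainder + a bounded reference sequence + the numeric ceiling match + the run-wise (PS) letter ⊢ END + the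
`K ≥ 1` window) and ★ `stabilityB_body_of_rung1At_of_runLetters` (θ-keyed) — read FOUR record-keyed helpers of dag-n10-d's S-class (`gamma_pos_of_…`, `construction_eq_of_…`,
`…_reletter_of_le`, `rgFlow_of_smallCouplings_of_…`), which at v10 are keyed on the CHOICE-centred provisos (plan g99 probe I.21959: «Application type mismatch»).  This file
re-issues both at the CENTRE-MAP-GENERIC S-class `Node00.IsRecordOfRecord₁₃CSepCoPHSCmap Χ D w` of `Node00/Record13SClassSepCoPHChiCmap` (this seat, plan g99 rows (2)(3)(4))
— so ONE proof serves every centre — and instantiates at the Ax class `Node00.IsRecordOfRecord₁₃CSepCoPHSAx` ∕ the Ax carriers; everything else in the body is datum- ∕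
world-generic and is CITED from the parent BY NAME (`upper_alongRun_of_runConstRemainder`, `partialSums_alongRun_of_runwisePS`, `frequently_betaZero_le_of_runConstRemainder`;
dag-n24-w1 `nodes_leavesP_reletter_of_le_all`; dag-n24-w1 g0 `endStatementBPrinted_of_nodesP_alongRuns_partialSums`; dag-n13-w4 `window_of_frequently_beta_le`).

WHAT IS HERE (theorems only; 0 `def`, 0 `sorry`, standard axioms):
* §1 ★ `endStatementBPrinted_window_of_isRecordOfRecord₁₃CSepCoPHSCmap_of_nodes_of_runLetters` (general `N`, ANY centre map `Χ`; the parent's §2 proof verbatim with the four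
  helpers re-pointed) · `endStatementBPrinted_window_of_isRecordOfRecord₁₃CSepCoPHSAx_of_nodes_of_runLetters` (the Ax instance, one line).
* §2 ★ `stabilityB_body_of_rung1At_of_runLetters_Ax` (θ-keyed at `Provisos₁₃SepCoPHAx`: unity ∧ `SlotsNondegenerate₁₃Ax`, admissibility, the K-Ax skeleton-local `RecordS` text (S-bound
  over the RE-CENTRED Stage-5 view `θ'.toStage5₁₃CoPHChi (chiβOfRecord₁₃Ax θ')`, = `Node00.recordS₁₃SepCoPHAx_iff`, `Iff.rfl`), nodes at every run, run letters for
  `betaOfRecord₁₃Ax θ` (= the Ax datum's `βfun`, `Node00.βfun_datumOfRecord₁₃SepCoPHAx`, `rfl`) ⊢ (unity ∧ slots) ∧ Admissible ∧ END ∧ window at `datumOfRecord₁₃SepCoPHAx θ h`) ·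
  `stabilityB_bodyV_of_rung1At_of_runLetters_Ax` (the same at the versioned Ax datum `datumOfRecord₁₃SepCoPHVAx θ h (Revision₁₃Ax.refl θ h)` — the door `datumOfRecord₁₃SepCoPHVAx_refl`,
  `rfl`) · ★★ `stabilityBRunRowsVAx_consequent_of_rung1At_of_runLetters_of_cont` (K1ᴬ's WHOLE consequent body after `∃ θ h v`, at `v := Revision₁₃Ax.refl θ h`: the rows conjunct is
  re-packaged from the displayed run letters `hrem ∕ hps` + the displayed survivor-continuity letter `hcont`, which the END road does not read).
* §3 ★★★ `stabilityBRunRowsAtRecordR13SepCoPHVAx_of_rung1WithRunLettersAt` — THE ROUTE DECL K1ᴬ BY NAME from ONE ∃-side producer «rung 1 WITH the run letters, the match and the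
  continuity letter AT THE WITNESS» (the parent's §4 first theorem under σ, in the run-LETTER currency: DEF-1's bundled `RunRemAt F κ θ h c` reads `h : Provisos₁₃SepCoPH` and has no
  Ax edition yet — HANDS-3 (v); the letters it would supply are displayed instead).  The TYPE is literally `Summit.QuantumFields.YangMills.Theses.BalabanUVNodes.StabilityBRunRowsAtRecordR13SepCoPHVAx`.

HONEST SCOPE ∕ A6.  Implications only; rung 1, the run letters, the match and the continuity letter are DISPLAYED hypotheses inhabited at NO θ here; the parent's v1.1 LOCATED note
(K1NEGCTL, refuter CRIT-1 p602267: a ceiling letter quantified over ALL rung-1 witnesses is vacuous-by-antecedent) applies verbatim — §3 keys the world AFTER the rows (∃-bundled), the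
live shape.  Nothing of Bałaban asserted; K1ᴬ NOT closed (DECIDING ∕ OPEN); no registered stub closed; N24 COMPOSITE — no discharge, no count claim (discharged 8∕27 · K 1∕4 unmoved).
One finite 𝕋⁴ programme at fixed ε, Bałaban AS PRINTED; R4 closes ONLY the conditional finite-𝕋⁴ rung `BalabanLadder.UV` — the YM mass gap (Clay) is NOT proved by any of this;
nothing continuum ∕ ℝ⁴ ∕ OS.  Theorems only: no `def`, no `instance`, no `sorry`, standard axioms.  References (context; nothing printed is used as a hypothesis): [I] =
[Balaban1987RG1] CMP **109** (1987): (0.17)–(0.20) pp.255–256, Thm 2 p.259, (1.20)–(1.22) p.264, Thm 3 p.264, (2.9) p.266 with (2.3) p.265, (5.10) p.293; [III] =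
[Balaban1988Convergent] CMP **119** (1988): (2.6) p.255, (2.18) p.257, Cor. 3 (2.50) p.264; [V] = [Balaban1989LargeFieldII] CMP **122** (1989): Thm 1 + (0.1) pp.355–356, p.391;
[14] = [Balaban1988RG2Cluster] CMP **116** (1988): (2.5)∕(2.9) (the re-centred cut-off).
-/

noncomputable section

open scoped Matrix.Norms.L2Operator
open Filter Topology

namespace Summit.QuantumFields.YangMills.BalabanUVNodes.K1EndOfNodes13PWSOfRunRemAtAx

open Literature.MathematicalPhysics.QuantumFieldTheory.Balaban1983to89
open Literature.MathematicalPhysics.QuantumFieldTheory.Balaban1983to89.Node00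
open DagBinding T4Continuum T4DatumAssembly FlowStepRuns
open FlowStep (HBeta RGEqH prefixOf prefixOf_apply BetaUpperH clampPrefix)
open Summit.QuantumFields.YangMills.Theorems.BalabanUVNodesK2NamedJetsRunRemAt (RunConstRemainder)
open Summit.QuantumFields.YangMills.BalabanUVNodes.K1BetaWindow13SOfNodes13PWSOfBoxH (nodes_leavesP_reletter_of_le_all)
open Summit.QuantumFields.YangMills.BalabanUVNodes.K1EndOfNodes13PWSOfPartialSums (endStatementBPrinted_of_nodesP_alongRuns_partialSums)
open Summit.QuantumFields.YangMills.Theorems.BalabanUVNodesK1WindowExactCriterion (window_of_frequently_beta_le)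
open Summit.QuantumFields.YangMills.BalabanUVNodes.K1EndOfNodes13PWSOfRunRemAt (upper_alongRun_of_runConstRemainder partialSums_alongRun_of_runwisePS
  frequently_betaZero_le_of_runConstRemainder)

/-! ## §1. ★ The END and the window AT ANY CENTRE-MAP S-CLASS RECORD from the thirteen nodes and RUN letters only (general `N`); the Ax instance -/

section AtRecord

variable {F : T4Family} {N : ℕ} [NeZero N]

/-- **★ END + WINDOW AT ANY CENTRE-MAP S-CLASS STAGE-13 RECORD `(D, w)` FROM THE NODES AND RUN LETTERS ONLY** (D-keyed, ANY centre map `Χ`).  Inputs: the thirteen DAG nodes at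
every run of `w`; on SOME level `γ₀ > 0`: DEF-1's run-wise constant remainder `RunConstRemainder D.βfun b r γ₀` relative to a reference sequence bounded by `B`, the numeric ceiling
match `B + r ≤ w.βup`, and the run-wise (PS) letter with defect `M`.  Output: `B16.EndStatementBPrinted D.C` and the `K ≥ 1` window at `D`.  Road = the parent's §2 VERBATIM: `M ≥ 0`
(empty sum at the one-point run `(γ₀)`); `c₀ := 1 − (1+w.β₀)⁻² > 0`; the world re-lettered to `γ₁ := min (min w.γ γ₀) √(c₀∕(M+1))` (nodes kept, S-class kept —
`Node00.isRecordOfRecord₁₃CSepCoPHSCmap_reletter_of_le`), so `M·γ₁² ≤ c₀`; guarded (0.20) by `Node00.rgFlow_of_smallCouplings_of_isRecordOfRecord₁₃CSepCoPHSCmap`; run-wise letters by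
the parent's §1 at `D.curries`; END by dag-n24-w1 g0's `endStatementBPrinted_of_nodesP_alongRuns_partialSums`; window by dag-n13-w4's `window_of_frequently_beta_le` from the
parent's level-0 bound.  NO box letter is read.  CONDITIONAL; nothing of Bałaban asserted; K1ᴬ NOT closed.
[cite: Balaban1989LargeFieldII, Thm 1 p.355 + (0.1) pp.355–356 + p.391; Balaban1988Convergent, (2.6) p.255, Cor. 3 (2.50) p.264; Balaban1987RG1, (0.17)–(0.20) pp.255–256, Thm 2 p.259, §1 (1.22) p.264, Thm 3 p.264, (2.9) p.266] -/
theorem endStatementBPrinted_window_of_isRecordOfRecord₁₃CSepCoPHSCmap_of_nodes_of_runLetters {Χ : Stage13Params F N → ChiSlot F N}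
    {D : FiniteEpsData F (SU N)} {w : WorldP}
    (hRS : IsRecordOfRecord₁₃CSepCoPHSCmap F N Χ D w) (hnodes : ∀ P : B12.RunParams, Nodes (leavesP w P))
    {b : ℕ → ℝ} {r γ₀ B M : ℝ} (hγ₀ : 0 < γ₀) (hrem : RunConstRemainder D.βfun b r γ₀) (hB : ∀ k, b k ≤ B) (hmatch : B + r ≤ w.βup)
    (hps : ∀ (n : ℕ) (gs : ℕ → ℝ), RGEqH n D.βfun gs → Step.InInterval γ₀ n gs → ∀ k, k ≤ n → -M ≤ ∑ j ∈ Finset.Ico k n, D.βfun j (prefixOf gs j)) :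
    B16.EndStatementBPrinted D.C ∧
      ∃ γ₁ : ℝ, 0 < γ₁ ∧ ∀ γ : ℝ, 0 < γ → γ ≤ γ₁ → ∃ P : B12.RunParams, 1 ≤ P.K ∧ (D.C P).flow.InInterval γ P.K := by
  have hγw : 0 < w.γ := gamma_pos_of_isRecordOfRecord₁₃CSepCoPHSCmap hRS
  have hC : w.C = D.C := construction_eq_of_isRecordOfRecord₁₃CSepCoPHSCmap hRS
  -- M ≥ 0 from the empty sum along the one-point run `(γ₀)`
  have hM : 0 ≤ M := by
    have hRG : RGEqH 0 D.βfun (fun _ => γ₀) := fun k hk => absurd hk (Nat.not_lt_zero k)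
    have hI : Step.InInterval γ₀ 0 (fun _ => γ₀) := fun _ _ => ⟨hγ₀, le_rfl⟩
    have h0 := hps 0 (fun _ => γ₀) hRG hI 0 le_rfl
    simp only [Finset.Ico_self, Finset.sum_empty] at h0
    linarith
  -- the smallness constant and the shrunk window
  set c₀ : ℝ := 1 - ((1 + w.β₀) ^ 2)⁻¹ with hc₀_def
  have hc₀ : 0 < c₀ := by
    have h1 : 1 < (1 + w.β₀) ^ 2 := by nlinarith [w.β₀_pos]
    have h2 : ((1 + w.β₀) ^ 2)⁻¹ < 1 := inv_lt_one_of_one_lt₀ h1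
    rw [hc₀_def]; linarith
  set γM : ℝ := Real.sqrt (c₀ / (M + 1)) with hγM_def
  have hγM : 0 < γM := Real.sqrt_pos.mpr (by positivity)
  set γ₁ : ℝ := min (min w.γ γ₀) γM with hγ₁_def
  have hγ₁ : 0 < γ₁ := lt_min (lt_min hγw hγ₀) hγM
  have hγ₁w : γ₁ ≤ w.γ := (min_le_left _ _).trans (min_le_left _ _)
  have hγ₁₀ : γ₁ ≤ γ₀ := (min_le_left _ _).trans (min_le_right _ _)
  have hsmall : M * γ₁ ^ 2 ≤ c₀ := by
    have h1 : γ₁ ^ 2 ≤ γM ^ 2 := pow_le_pow_left₀ hγ₁.le (min_le_right _ _) 2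
    have h2 : γM ^ 2 = c₀ / (M + 1) := by rw [hγM_def, Real.sq_sqrt (by positivity)]
    have h3 : M * (c₀ / (M + 1)) ≤ c₀ := by
      rw [mul_div_assoc']
      rw [div_le_iff₀ (by positivity)]
      nlinarith [hc₀, hM]
    calc M * γ₁ ^ 2 ≤ M * γM ^ 2 := mul_le_mul_of_nonneg_left h1 hM
      _ = M * (c₀ / (M + 1)) := by rw [h2]
      _ ≤ c₀ := h3
  -- the re-lettered world and the END along runs
  have hRS' : IsRecordOfRecord₁₃CSepCoPHSCmap F N Χ D { w with γ := γ₁, b := w.b, b_pos := w.b_pos } :=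
    isRecordOfRecord₁₃CSepCoPHSCmap_reletter_of_le hRS hγ₁ hγ₁w w.b_pos
  have hB : B16.EndStatementBPrinted ({ w with γ := γ₁, b := w.b, b_pos := w.b_pos } : WorldP).C := by
    refine endStatementBPrinted_of_nodesP_alongRuns_partialSums { w with γ := γ₁, b := w.b, b_pos := w.b_pos } hγ₁ (M := M)
      (nodes_leavesP_reletter_of_le_all w hγ₁w w.b_pos hnodes)
      (fun P hsc => rgFlow_of_smallCouplings_of_isRecordOfRecord₁₃CSepCoPHSCmap hRS' P hsc) (fun P hsc => ?_) (fun P hsc => ?_) hsmall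
    · have hrgP : (D.C.toB12 P).flow.SatisfiesRG P.K := by
        have h' := rgFlow_of_smallCouplings_of_isRecordOfRecord₁₃CSepCoPHSCmap hRS' P hsc
        show (D.C P).flow.SatisfiesRG P.K
        rw [← hC]; exact h'
      have hsc' : (D.C.toB12 P).flow.InInterval γ₁ P.K := by
        show (D.C P).flow.InInterval γ₁ P.K
        rw [← hC]; exact hsc
      show ∀ j, j < P.K → (w.C P).flow.β (j + 1) ((w.C P).flow.g j) ≤ w.βup
      rw [hC]
      exact fun j hj => (upper_alongRun_of_runConstRemainder D.C.toB12 D.βfun D.curries hγ₁₀ hrem hB P hrgP hsc' j hj).trans hmatch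
    · have hrgP : (D.C.toB12 P).flow.SatisfiesRG P.K := by
        have h' := rgFlow_of_smallCouplings_of_isRecordOfRecord₁₃CSepCoPHSCmap hRS' P hsc
        show (D.C P).flow.SatisfiesRG P.K
        rw [← hC]; exact h'
      have hsc' : (D.C.toB12 P).flow.InInterval γ₁ P.K := by
        show (D.C P).flow.InInterval γ₁ P.K
        rw [← hC]; exact hsc
      show ∀ m n, m ≤ n → n ≤ P.K → -M ≤ ∑ j ∈ Finset.Ico m n, (w.C P).flow.β (j + 1) ((w.C P).flow.g j)
      rw [hC]
      exact partialSums_alongRun_of_runwisePS D.C.toB12 D.βfun D.curries hγ₁₀ hps P hrgP hsc'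
  refine ⟨?_, window_of_frequently_beta_le D (frequently_betaZero_le_of_runConstRemainder hγ₀ hrem)⟩
  have : ({ w with γ := γ₁, b := w.b, b_pos := w.b_pos } : WorldP).C = D.C := hC
  rw [← this]
  exact hB

/-- **The Ax instance**: END + window at any Ax-S-class record `Node00.IsRecordOfRecord₁₃CSepCoPHSAx F N D w` (the centre map `Χ := chiβOfRecord₁₃Ax F N`; one line).
[cite: Balaban1989LargeFieldII, Thm 1 p.355 + (0.1) pp.355–356; Balaban1987RG1, (0.20) p.256, Thm 3 p.264, (2.9) p.266 with (2.3) p.265 (bookkeeping)] -/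
theorem endStatementBPrinted_window_of_isRecordOfRecord₁₃CSepCoPHSAx_of_nodes_of_runLetters {D : FiniteEpsData F (SU N)} {w : WorldP}
    (hRS : IsRecordOfRecord₁₃CSepCoPHSAx F N D w) (hnodes : ∀ P : B12.RunParams, Nodes (leavesP w P))
    {b : ℕ → ℝ} {r γ₀ B M : ℝ} (hγ₀ : 0 < γ₀) (hrem : RunConstRemainder D.βfun b r γ₀) (hB : ∀ k, b k ≤ B) (hmatch : B + r ≤ w.βup)
    (hps : ∀ (n : ℕ) (gs : ℕ → ℝ), RGEqH n D.βfun gs → Step.InInterval γ₀ n gs → ∀ k, k ≤ n → -M ≤ ∑ j ∈ Finset.Ico k n, D.βfun j (prefixOf gs j)) :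
    B16.EndStatementBPrinted D.C ∧
      ∃ γ₁ : ℝ, 0 < γ₁ ∧ ∀ γ : ℝ, 0 < γ → γ ≤ γ₁ → ∃ P : B12.RunParams, 1 ≤ P.K ∧ (D.C P).flow.InInterval γ P.K :=
  endStatementBPrinted_window_of_isRecordOfRecord₁₃CSepCoPHSCmap_of_nodes_of_runLetters hRS hnodes hγ₀ hrem hB hmatch hps

end AtRecord

/-! ## §2. ★ The crux's consequent AT θ at the RE-CENTRED record from a rung-1 datum and RUN letters only (general `N`) -/

section AtTheta

variable {F : T4Family} {N : ℕ} [NeZero N]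

/-- **★ THE K1ᴬ CONSEQUENT's (unity ∧ slots) ∧ admissibility ∧ END ∧ window AT θ FROM A RUNG-1 DATUM AND RUN LETTERS ONLY, RE-CENTRED** (θ-keyed at `Provisos₁₃SepCoPHAx`; the
K-Ax skeleton-local `RecordS F θ h w` spelled out — S-bound over the re-centred Stage-5 view, `Node00.recordS₁₃SepCoPHAx_iff`): unity ∧ `SlotsNondegenerate₁₃Ax`, admissibility, an
S-bound world of the Ax datum with the thirteen nodes at every run, and on SOME level `γ₀ > 0` the run letters of the D-keyed headline for `betaOfRecord₁₃Ax θ` (= the Ax datum's `βfun`,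
`Node00.βfun_datumOfRecord₁₃SepCoPHAx`, `rfl`) ⊢ the (B)+window part of `StabilityBRunRowsAtRecordR13SepCoPHVAx`'s body AT θ (trivial revision).  CONDITIONAL; closes nothing.
[cite: Balaban1989LargeFieldII, Thm 1 p.355 + (0.1) pp.355–356 + p.391; Balaban1988Convergent, (2.6) p.255, Cor. 3 (2.50) p.264; Balaban1987RG1, (0.20) p.256, Thm 2 p.259, Thm 3 p.264, (2.9) p.266 (bookkeeping)] -/
theorem stabilityB_body_of_rung1At_of_runLetters_Ax (θ : Stage13HParams F N) (h : θ.Provisos₁₃SepCoPHAx F N) (w : WorldP)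
    (hU : θ.ZhUnity F N ∧ θ.SlotsNondegenerate₁₃Ax F N) (hθ : θ.Admissible F N)
    (hR : ∃ (θ' : Stage13HParams F N) (h' : θ'.Provisos₁₃SepCoPHAx F N), θ'.Admissible F N ∧
      datumOfRecord₁₃SepCoPHAx F N θ h = datumOfRecord₁₃SepCoPHAx F N θ' h' ∧ w.C = (datumOfRecord₁₃SepCoPHAx F N θ h).C ∧ (0 < w.γ ∧ w.γ ≤ θ'.γ) ∧
      w.L = (θ'.L : ℝ) ∧ ∀ P : B12.RunParams, w.up P = upOfRecord₅CS F N (θ'.toStage5₁₃CoPHChi F N (chiβOfRecord₁₃Ax F N θ'.toStage13Params)) P)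
    (hnodes : ∀ P : B12.RunParams, Nodes (leavesP w P))
    {b : ℕ → ℝ} {r γ₀ B M : ℝ} (hγ₀ : 0 < γ₀) (hrem : RunConstRemainder (betaOfRecord₁₃Ax F N θ.toStage13Params) b r γ₀) (hB : ∀ k, b k ≤ B)
    (hmatch : B + r ≤ w.βup)
    (hps : ∀ (n : ℕ) (gs : ℕ → ℝ), RGEqH n (betaOfRecord₁₃Ax F N θ.toStage13Params) gs → Step.InInterval γ₀ n gs →
      ∀ k, k ≤ n → -M ≤ ∑ j ∈ Finset.Ico k n, betaOfRecord₁₃Ax F N θ.toStage13Params j (prefixOf gs j)) :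
    (θ.ZhUnity F N ∧ θ.SlotsNondegenerate₁₃Ax F N) ∧ θ.Admissible F N ∧ B16.EndStatementBPrinted (datumOfRecord₁₃SepCoPHAx F N θ h).C ∧
      ∃ γ₁ : ℝ, 0 < γ₁ ∧ ∀ γ : ℝ, 0 < γ → γ ≤ γ₁ → ∃ P : B12.RunParams, 1 ≤ P.K ∧ ((datumOfRecord₁₃SepCoPHAx F N θ h).C P).flow.InInterval γ P.K :=
  ⟨hU, hθ, endStatementBPrinted_window_of_isRecordOfRecord₁₃CSepCoPHSAx_of_nodes_of_runLetters ((recordS₁₃SepCoPHAx_iff θ h w).1 hR) hnodes hγ₀ hrem hB hmatch hps⟩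

/-- **The same at the VERSIONED Ax datum, trivial revision** `datumOfRecord₁₃SepCoPHVAx θ h (Revision₁₃Ax.refl θ h)` — the door `Node00.datumOfRecord₁₃SepCoPHVAx_refl` (`rfl`); this is the
shape of K1ᴬ's `(B) ∧ window` conjuncts with `v := Revision₁₃Ax.refl θ h`.  CONDITIONAL; closes nothing.
[cite: Balaban1989LargeFieldII, Thm 1 p.355 + (0.1) pp.355–356; Balaban1988Convergent, (2.18) p.257, Cor. 3 (2.50) p.264 (bookkeeping)] -/
theorem stabilityB_bodyV_of_rung1At_of_runLetters_Ax (θ : Stage13HParams F N) (h : θ.Provisos₁₃SepCoPHAx F N) (w : WorldP)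
    (hU : θ.ZhUnity F N ∧ θ.SlotsNondegenerate₁₃Ax F N) (hθ : θ.Admissible F N)
    (hR : ∃ (θ' : Stage13HParams F N) (h' : θ'.Provisos₁₃SepCoPHAx F N), θ'.Admissible F N ∧
      datumOfRecord₁₃SepCoPHAx F N θ h = datumOfRecord₁₃SepCoPHAx F N θ' h' ∧ w.C = (datumOfRecord₁₃SepCoPHAx F N θ h).C ∧ (0 < w.γ ∧ w.γ ≤ θ'.γ) ∧
      w.L = (θ'.L : ℝ) ∧ ∀ P : B12.RunParams, w.up P = upOfRecord₅CS F N (θ'.toStage5₁₃CoPHChi F N (chiβOfRecord₁₃Ax F N θ'.toStage13Params)) P)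
    (hnodes : ∀ P : B12.RunParams, Nodes (leavesP w P))
    {b : ℕ → ℝ} {r γ₀ B M : ℝ} (hγ₀ : 0 < γ₀) (hrem : RunConstRemainder (betaOfRecord₁₃Ax F N θ.toStage13Params) b r γ₀) (hB : ∀ k, b k ≤ B)
    (hmatch : B + r ≤ w.βup)
    (hps : ∀ (n : ℕ) (gs : ℕ → ℝ), RGEqH n (betaOfRecord₁₃Ax F N θ.toStage13Params) gs → Step.InInterval γ₀ n gs →
      ∀ k, k ≤ n → -M ≤ ∑ j ∈ Finset.Ico k n, betaOfRecord₁₃Ax F N θ.toStage13Params j (prefixOf gs j)) :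
    (θ.ZhUnity F N ∧ θ.SlotsNondegenerate₁₃Ax F N) ∧ θ.Admissible F N ∧
      B16.EndStatementBPrinted (datumOfRecord₁₃SepCoPHVAx F N θ h (Revision₁₃Ax.refl F N θ h)).C ∧
      ∃ γ₁ : ℝ, 0 < γ₁ ∧ ∀ γ : ℝ, 0 < γ → γ ≤ γ₁ →
        ∃ P : B12.RunParams, 1 ≤ P.K ∧ ((datumOfRecord₁₃SepCoPHVAx F N θ h (Revision₁₃Ax.refl F N θ h)).C P).flow.InInterval γ P.K :=
  stabilityB_body_of_rung1At_of_runLetters_Ax θ h w hU hθ hR hnodes hγ₀ hrem hB hmatch hps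

/-- **★★ K1ᴬ's WHOLE CONSEQUENT BODY AT `(θ, h, Revision₁₃Ax.refl θ h)`** from the same inputs PLUS the survivor-continuity letter `hcont` of the run rows (displayed, UNREAD by the END
road; it only rides into the rows conjunct): (unity ∧ slots) ∧ Admissible ∧ END ∧ window ∧ `∃ b r γ₀ M, 0 < γ₀ ∧ (i) ∧ (iv) ∧ (C)` for `betaOfRecord₁₃Ax θ` — literally the text after
`∃ θ h v,` of `StabilityBRunRowsAtRecordR13SepCoPHVAx`.  The run-wise constant remainder conjunct (i) is DEF-1's `RunConstRemainder` UNFOLDED.  CONDITIONAL; closes nothing.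
[cite: Balaban1989LargeFieldII, Thm 1 p.355 + (0.1) pp.355–356 + p.391; Balaban1987RG1, Thm 2 p.259, Thm 3 p.264, (5.10) p.293, §1 pp.263–264 (the continuity letter; bookkeeping)] -/
theorem stabilityBRunRowsVAx_consequent_of_rung1At_of_runLetters_of_cont (θ : Stage13HParams F N) (h : θ.Provisos₁₃SepCoPHAx F N) (w : WorldP)
    (hU : θ.ZhUnity F N ∧ θ.SlotsNondegenerate₁₃Ax F N) (hθ : θ.Admissible F N)
    (hR : ∃ (θ' : Stage13HParams F N) (h' : θ'.Provisos₁₃SepCoPHAx F N), θ'.Admissible F N ∧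
      datumOfRecord₁₃SepCoPHAx F N θ h = datumOfRecord₁₃SepCoPHAx F N θ' h' ∧ w.C = (datumOfRecord₁₃SepCoPHAx F N θ h).C ∧ (0 < w.γ ∧ w.γ ≤ θ'.γ) ∧
      w.L = (θ'.L : ℝ) ∧ ∀ P : B12.RunParams, w.up P = upOfRecord₅CS F N (θ'.toStage5₁₃CoPHChi F N (chiβOfRecord₁₃Ax F N θ'.toStage13Params)) P)
    (hnodes : ∀ P : B12.RunParams, Nodes (leavesP w P))
    {b : ℕ → ℝ} {r γ₀ B M : ℝ} (hγ₀ : 0 < γ₀) (hrem : RunConstRemainder (betaOfRecord₁₃Ax F N θ.toStage13Params) b r γ₀) (hB : ∀ k, b k ≤ B)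
    (hmatch : B + r ≤ w.βup)
    (hps : ∀ (n : ℕ) (gs : ℕ → ℝ), RGEqH n (betaOfRecord₁₃Ax F N θ.toStage13Params) gs → Step.InInterval γ₀ n gs →
      ∀ k, k ≤ n → -M ≤ ∑ j ∈ Finset.Ico k n, betaOfRecord₁₃Ax F N θ.toStage13Params j (prefixOf gs j))
    (hcont : ∀ k : ℕ, ContinuousOn (fun x : ℝ => betaOfRecord₁₃Ax F N θ.toStage13Params k (clampPrefix (betaOfRecord₁₃Ax F N θ.toStage13Params) γ₀ k x))
      {x : ℝ | 0 < x ∧ x ≤ γ₀ ∧ ∀ j, j ≤ k → 1 / γ₀ ^ 2 ≤ FlowStep.Y (betaOfRecord₁₃Ax F N θ.toStage13Params) γ₀ j x}) :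
    (θ.ZhUnity F N ∧ θ.SlotsNondegenerate₁₃Ax F N) ∧ θ.Admissible F N ∧
      B16.EndStatementBPrinted (datumOfRecord₁₃SepCoPHVAx F N θ h (Revision₁₃Ax.refl F N θ h)).C ∧
      (∃ γ₁ : ℝ, 0 < γ₁ ∧ ∀ γ : ℝ, 0 < γ → γ ≤ γ₁ →
        ∃ P : B12.RunParams, 1 ≤ P.K ∧ ((datumOfRecord₁₃SepCoPHVAx F N θ h (Revision₁₃Ax.refl F N θ h)).C P).flow.InInterval γ P.K) ∧
      ∃ (b : ℕ → ℝ) (r γ₀ M : ℝ), 0 < γ₀ ∧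
        (∀ (n : ℕ) (gs : ℕ → ℝ), RGEqH n (betaOfRecord₁₃Ax F N θ.toStage13Params) gs → Step.InInterval γ₀ n gs →
          ∀ k, k ≤ n → |betaOfRecord₁₃Ax F N θ.toStage13Params k (prefixOf gs k) - b k| ≤ r) ∧
        (∀ (n : ℕ) (gs : ℕ → ℝ), RGEqH n (betaOfRecord₁₃Ax F N θ.toStage13Params) gs → Step.InInterval γ₀ n gs →
          ∀ k, k ≤ n → -M ≤ ∑ j ∈ Finset.Ico k n, betaOfRecord₁₃Ax F N θ.toStage13Params j (prefixOf gs j)) ∧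
        ∀ k : ℕ, ContinuousOn (fun x : ℝ => betaOfRecord₁₃Ax F N θ.toStage13Params k (clampPrefix (betaOfRecord₁₃Ax F N θ.toStage13Params) γ₀ k x))
          {x : ℝ | 0 < x ∧ x ≤ γ₀ ∧ ∀ j, j ≤ k → 1 / γ₀ ^ 2 ≤ FlowStep.Y (betaOfRecord₁₃Ax F N θ.toStage13Params) γ₀ j x} := by
  obtain ⟨hU', hθ', hEnd, hwin⟩ := stabilityB_bodyV_of_rung1At_of_runLetters_Ax θ h w hU hθ hR hnodes hγ₀ hrem hB hmatch hps
  exact ⟨hU', hθ', hEnd, hwin, b, r, γ₀, M, hγ₀, hrem, hps, hcont⟩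

end AtTheta

/-! ## §3. ★★★ The ROUTE DECL K1ᴬ BY NAME from ONE ∃-side producer «rung 1 WITH the run letters, the match and the continuity letter AT THE WITNESS» -/

section Registered

/-- **★★★ K1ᴬ BY NAME FROM ONE ∃-SIDE PRODUCER** (the parent's §4 first theorem under σ, run-LETTER currency).  `hprod` says: for every family `F` with a unity Stage-13 tuple at the
re-centred record (K0ᴬ's conclusion), SOME unity tuple `θ` with Ax provisos `h` carries, on SOME level `γ₀ > 0`, the run letters of `betaOfRecord₁₃Ax θ` (DEF-1's run-wise constant
remainder relative to a reference sequence bounded by `B`, the run-wise (PS) letter with defect `M`, the survivor-continuity letter) AND an S-bound world of its Ax datum (the K-Ax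
`RecordS`, spelled out) whose ceiling clears `B + r` and all of whose runs' leaf worlds satisfy the thirteen DAG nodes.  Conclusion:
`Summit.QuantumFields.YangMills.Theses.BalabanUVNodes.StabilityBRunRowsAtRecordR13SepCoPHVAx` — the TYPE is the route decl literally (witness `v := Revision₁₃Ax.refl θ h`).  The world
is keyed AFTER the rows (∃-bundled) — the live shape per the parent's v1.1 LOCATED note (K1NEGCTL).  CONDITIONAL on `hprod` (not supplied here); K1ᴬ is NOT closed by this theorem;
nothing of Bałaban asserted; no count moved.
[cite: Balaban1989LargeFieldII, Thm 1 p.355 + (0.1) pp.355–356 + p.391; Balaban1987RG1, Thm 2 p.259, Thm 3 p.264, (1.20)–(1.22) p.264, (2.9) p.266, (5.10) p.293; Balaban1988Convergent, (2.6) p.255 and Cor. 3 (2.50) p.264 (bookkeeping)] -/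
theorem stabilityBRunRowsAtRecordR13SepCoPHVAx_of_rung1WithRunLettersAt
    (hprod : ∀ F : T4Family,
      (∃ θ : Stage13HParams F 2, θ.Provisos₁₃SepCoPHAx F 2 ∧ (θ.ZhUnity F 2 ∧ θ.SlotsNondegenerate₁₃Ax F 2) ∧ θ.Admissible F 2) →
      ∃ (θ : Stage13HParams F 2) (h : θ.Provisos₁₃SepCoPHAx F 2), (θ.ZhUnity F 2 ∧ θ.SlotsNondegenerate₁₃Ax F 2) ∧ θ.Admissible F 2 ∧
        ∃ (b : ℕ → ℝ) (r γ₀ B M : ℝ), 0 < γ₀ ∧ RunConstRemainder (betaOfRecord₁₃Ax F 2 θ.toStage13Params) b r γ₀ ∧ (∀ k, b k ≤ B) ∧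
          (∀ (n : ℕ) (gs : ℕ → ℝ), RGEqH n (betaOfRecord₁₃Ax F 2 θ.toStage13Params) gs → Step.InInterval γ₀ n gs →
            ∀ k, k ≤ n → -M ≤ ∑ j ∈ Finset.Ico k n, betaOfRecord₁₃Ax F 2 θ.toStage13Params j (prefixOf gs j)) ∧
          (∀ k : ℕ, ContinuousOn (fun x : ℝ => betaOfRecord₁₃Ax F 2 θ.toStage13Params k (clampPrefix (betaOfRecord₁₃Ax F 2 θ.toStage13Params) γ₀ k x))
            {x : ℝ | 0 < x ∧ x ≤ γ₀ ∧ ∀ j, j ≤ k → 1 / γ₀ ^ 2 ≤ FlowStep.Y (betaOfRecord₁₃Ax F 2 θ.toStage13Params) γ₀ j x}) ∧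
          ∃ w : WorldP, B + r ≤ w.βup ∧
            (∃ (θ' : Stage13HParams F 2) (h' : θ'.Provisos₁₃SepCoPHAx F 2), θ'.Admissible F 2 ∧
              datumOfRecord₁₃SepCoPHAx F 2 θ h = datumOfRecord₁₃SepCoPHAx F 2 θ' h' ∧ w.C = (datumOfRecord₁₃SepCoPHAx F 2 θ h).C ∧ (0 < w.γ ∧ w.γ ≤ θ'.γ) ∧
              w.L = (θ'.L : ℝ) ∧ ∀ P : B12.RunParams, w.up P = upOfRecord₅CS F 2 (θ'.toStage5₁₃CoPHChi F 2 (chiβOfRecord₁₃Ax F 2 θ'.toStage13Params)) P) ∧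
            ∀ P : B12.RunParams, Nodes (leavesP w P)) :
    Summit.QuantumFields.YangMills.Theses.BalabanUVNodes.StabilityBRunRowsAtRecordR13SepCoPHVAx := by
  intro F hinh
  obtain ⟨θ, hP, hU, hθ, b, r, γ₀, B, M, hγ₀, hrem, hB, hps, hcont, w, hmatch, hR, hnodes⟩ := hprod F hinh
  exact ⟨θ, hP, Revision₁₃Ax.refl F 2 θ hP,
    stabilityBRunRowsVAx_consequent_of_rung1At_of_runLetters_of_cont θ hP w hU hθ hR hnodes hγ₀ hrem hB hmatch hps hcont⟩

end Registered

end Summit.QuantumFields.YangMills.BalabanUVNodes.K1EndOfNodes13PWSOfRunRemAtAx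

end
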